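import Literature.Topology.FourManifolds.TautFoliationsCollarRadial
import Literature.Topology.FourManifolds.TautFoliationsCollarConeFine
import HarnessLib

/-!
# The wiggly rings of the coned fence collar: the level sets square by square

Topic: the coned fence collar (C4b of the plan). Let `P` be a cone position of the collar disc
`G` with mesh `≥ 32` keeping `G` on the outer-collar edges, and `R` a radius with
`15L/16 ≤ R`. Every grid square `Q` meeting the ring `sphere c₀ R` lies in the outer collar
(`sq_subset_collar_of_mesh`), so its boundary heights are radial (`isRadial_bdryHt`) and the
contour line of its cone at the radial height of `R` is a connected compact arc meeting `∂Q`
exactly on the ring (`RadialSquares`). The **wiggly ring** `W_R` is the union of these arcs over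
the squares meeting the ring: a compact subset of the closed big square containing the ring
points of the 1-skeleton... (its leaf structure is the object of the sequel).

* `ConePosition.ringLevel` (**definition**: the contour arc of a square at the radius `R`),
  `ringLevel_subset_sq`, `isCompact_ringLevel`, `isPreconnected_ringLevel`, `ringLevel_inter_sphere`
  (**proved**);
* `ConePosition.wigglyRing` (**definition**), `isCompact_wigglyRing`, `mem_wigglyRing_of_mem_sphere`,
  `wigglyRing_subset` (**proved**); `exists_mem_sphere_ring`, `radialHt_lt_apex_or` (**proved**).

All statements are [folklore].
-/

noncomputable section

open Set Filter Metric Topology Function Real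
open scoped unitInterval

namespace Literature.Topology.FourManifolds

namespace Foliation.ConePosition

open SquareGrid SquareGrid.Grid SquarePolar ConeSquare CollarRadius

variable {B : Type*} [NormedAddCommGroup B] [NormedSpace ℝ B] {M : Type*} [TopologicalSpace M] {F : Foliation B M}
variable {Γ : C(I, F.GermSpace)} {τ₀ ε : ℝ} {Φ : I → ℝ → M} {c₀ : ℝ × ℝ} {L : ℝ} {hL : 0 < L} {G : ℝ × ℝ → M}
variable (P : ConePosition F G c₀ hL)

/-- **The contour arc of the square `Q` at the radius `R`**: the contour line of the cone of `Q`
at the radial height of `R`. [folklore] -/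
def ringLevel (q : Fin P.n × Fin P.n) (R : ℝ) : Set (ℝ × ℝ) :=
  levelLine (P.gr.centre q) P.gr.ℓ (P.apex q) (P.bdryHt q) (P.radialHt q R)

omit [NormedSpace ℝ B] in
/-- The contour arc lies in the closed square. [folklore] -/
theorem ringLevel_subset_sq (q : Fin P.n × Fin P.n) (R : ℝ) : P.ringLevel q R ⊆ P.gr.sq q := fun _ hx ↦ hx.1

/-- **The wiggly ring at radius `R`**: the union of the contour arcs of the squares meeting the
ring `sphere c₀ R`. [folklore] -/
def wigglyRing (R : ℝ) : Set (ℝ × ℝ) :=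
  ⋃ q ∈ {q : Fin P.n × Fin P.n | (P.gr.sq q ∩ sphere c₀ R).Nonempty}, P.ringLevel q R

section Ring

variable (hΦ : IsFenceOn F Γ τ₀ ε Φ univ) (hcl : ∀ τ ∈ Ioo (τ₀ - ε) (τ₀ + ε), Φ 1 τ = Φ 0 τ) {τ₁ : ℝ}
  (hτI : uIcc τ₀ τ₁ ⊆ Ioo (τ₀ - ε) (τ₀ + ε)) (h01 : τ₁ ≠ τ₀)
  (hG : ∀ x, L / 2 ≤ dist x c₀ → G x = Φ (angleParam c₀ x) (levelOfParam τ₀ τ₁ (1 - dist x c₀ / L)))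
  (hGc : Continuous G) (hn32 : 32 ≤ P.n)
  (hskelT : ∀ q k, P.gr.edge q k '' Icc 0 (2 * P.gr.ℓ) ⊆ {x | 7 * L / 8 ≤ dist x c₀} →
    ∀ s ∈ Icc 0 (2 * P.gr.ℓ), P.skel (P.gr.edge q k s) = G (P.gr.edge q k s))
  {R : ℝ} (hR : 15 * L / 16 ≤ R) {q : Fin P.n × Fin P.n} (hqR : (P.gr.sq q ∩ sphere c₀ R).Nonempty)

include hn32 hR hqR in
omit [NormedSpace ℝ B] in
/-- A square meeting the ring lies in the outer collar. [folklore] -/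
theorem sq_subset_collar : ∀ x ∈ P.gr.sq q, 7 * L / 8 ≤ dist x c₀ := by
  obtain ⟨x₀, hx₀, hx₀R⟩ := hqR
  exact sq_subset_collar_of_mesh hL P.hn hn32 q hx₀ hR (mem_sphere.1 hx₀R)

include hn32 hR hqR hskelT in
omit [NormedSpace ℝ B] in
/-- On the boundary of a square meeting the ring the skeleton is the disc map. [folklore] -/
theorem skel_eq_of_mem_sphere_ring {x : ℝ × ℝ} (hx : x ∈ sphere (P.gr.centre q) P.gr.ℓ) : P.skel x = G x := by
  obtain ⟨k, s, hs, rfl⟩ := P.gr.exists_edge_eq_of_mem_sphere hx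
  refine hskelT q k (fun y hy ↦ ?_) s hs
  obtain ⟨s', hs', rfl⟩ := hy
  exact P.sq_subset_collar hn32 hR hqR _ (P.gr.edge_mem_sq q k hs')

include hΦ hcl hτI h01 hG hGc hn32 hskelT hR hqR in
omit [NormedSpace ℝ B] in
/-- The boundary heights of a square meeting the ring are radial. [folklore] -/
theorem isRadial_of_ring : ConeSquare.IsRadial c₀ (P.gr.centre q) P.gr.ℓ (P.bdryHt q) (P.radialHt q)
    (Icc (dist (P.gr.centre q) c₀ - P.gr.ℓ) (dist (P.gr.centre q) c₀ + P.gr.ℓ)) :=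
  P.isRadial_bdryHt hΦ hcl hτI h01 hG hGc (P.sq_subset_collar hn32 hR hqR)
    (fun _ hx ↦ P.skel_eq_of_mem_sphere_ring hn32 hskelT hR hqR hx)

include hqR in
omit [NormedSpace ℝ B] in
/-- The radius `R` is in the radius range of a square meeting the ring, and exceeds `ℓ`. [folklore] -/
theorem radius_mem_range : R ∈ Icc (dist (P.gr.centre q) c₀ - P.gr.ℓ) (dist (P.gr.centre q) c₀ + P.gr.ℓ) := by
  obtain ⟨x₀, hx₀, hx₀R⟩ := hqR
  have h := abs_dist_sub_le x₀ (P.gr.centre q) c₀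
  rw [mem_sphere.1 hx₀R, abs_le] at h
  have hx₀q : dist x₀ (P.gr.centre q) ≤ P.gr.ℓ := mem_closedBall.1 hx₀
  exact ⟨by linarith [h.1], by linarith [h.2]⟩

include hn32 hR in
omit [NormedSpace ℝ B] in
/-- The mesh is smaller than the radius. [folklore] -/
theorem ℓ_lt_radius : P.gr.ℓ < R := by
  have hℓ : P.gr.ℓ = L / P.n := grid_ℓ hL P.hn
  have hn' : (32 : ℝ) ≤ P.n := by exact_mod_cast hn32
  have hℓle : P.gr.ℓ ≤ L / 32 := by rw [hℓ]; exact div_le_div_of_nonneg_left hL.le (by norm_num) hn'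
  linarith

include hn32 hR hqR in
omit [NormedSpace ℝ B] in
/-- **The ring meets the boundary of every square it meets.** [folklore] -/
theorem exists_mem_sphere_ring : ∃ y ∈ sphere (P.gr.centre q) P.gr.ℓ, dist y c₀ = R := by
  have hℓ := P.gr.hℓ
  have hℓR := P.ℓ_lt_radius hn32 hR
  obtain ⟨x₀, hx₀, hx₀R⟩ := hqR
  have hR0 : 0 ≤ R := dist_nonneg.trans_eq (mem_sphere.1 hx₀R)
  set cq := P.gr.centre q with hcq
  -- the ring is connected
  have hring : IsPreconnected (sphere c₀ R) := by
    have hrank : 1 < Module.rank ℝ (ℝ × ℝ) := by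
      rw [rank_prod', Module.rank_self]; norm_num
    exact (isConnected_sphere hrank c₀ hR0).isPreconnected
  -- it contains a point outside the closed square: the antipode of `x₀`
  set x₁ : ℝ × ℝ := c₀ + (c₀ - x₀) with hx₁
  have hx₁R : x₁ ∈ sphere c₀ R := by
    rw [mem_sphere, dist_eq_norm, hx₁, add_sub_cancel_left, ← dist_eq_norm, ← mem_sphere.1 hx₀R, dist_comm]
  have hx₁out : x₁ ∉ closedBall cq P.gr.ℓ := fun h ↦ by
    have h1 : dist x₁ x₀ ≤ 2 * P.gr.ℓ := by
      have := dist_triangle x₁ cq x₀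
      rw [mem_closedBall] at h; have h' := mem_closedBall.1 hx₀; rw [dist_comm] at h'; linarith
    have h2 : dist x₁ x₀ = 2 * R := by
      rw [dist_eq_norm, hx₁, show c₀ + (c₀ - x₀) - x₀ = (2 : ℝ) • (c₀ - x₀) by rw [two_smul]; abel, norm_smul,
        Real.norm_eq_abs, abs_of_pos two_pos, ← dist_eq_norm, dist_comm, mem_sphere.1 hx₀R]
    linarith
  -- if the ring missed the boundary square it would lie outside the closed square
  by_contra hnone
  push Not at hnone
  have hsub : sphere c₀ R ⊆ (closedBall cq P.gr.ℓ)ᶜ := by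
    refine hring.subset_of_closure_inter_subset isClosed_closedBall.isOpen_compl ⟨x₁, hx₁R, hx₁out⟩ ?_
    -- `closure (closedBall)ᶜ ∩ ring ⊆ (closedBall)ᶜ`: a ring point in the closure is not in the open ball, nor on the sphere
    rintro y ⟨hycl, hyR⟩ hyb
    have hnotball : y ∉ ball cq P.gr.ℓ := fun hb ↦ by
      -- the open ball is an open set inside `closedBall`, disjoint from `(closedBall)ᶜ`
      have : y ∈ interior (closedBall cq P.gr.ℓ) := interior_maximal ball_subset_closedBall isOpen_ball hb
      rw [← compl_compl (closedBall cq P.gr.ℓ), interior_compl] at this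
      exact this hycl
    have hysph : y ∈ sphere cq P.gr.ℓ := by
      rw [mem_sphere]; rw [mem_closedBall] at hyb; rw [mem_ball, not_lt] at hnotball; linarith
    exact absurd (mem_sphere.1 hyR) (hnone y hysph)
  exact hsub hx₀R hx₀

include hΦ hcl hτI h01 hG hGc hn32 hskelT hR hqR in
omit [NormedSpace ℝ B] in
/-- The radial height of `R` is a boundary height of the square: below the apex for a roof,
above for a floor. [folklore] -/
theorem radialHt_lt_apex_or : (P.roofPat q → P.radialHt q R < P.apex q) ∧ (¬ P.roofPat q → P.apex q < P.radialHt q R) := by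
  obtain ⟨y, hy, hyR⟩ := P.exists_mem_sphere_ring hn32 hR hqR
  have hrad := P.isRadial_of_ring hΦ hcl hτI h01 hG hGc hn32 hskelT hR hqR
  have heq : P.radialHt q R = P.bdryHt q y := by rw [hrad.eq y hy, hyR]
  rw [heq]
  exact ⟨fun h ↦ P.apex_spec.2.1 q h y hy, fun h ↦ P.apex_spec.2.2 q h y hy⟩

include hΦ hcl hτI h01 hG hGc hn32 hskelT hR hqR in
omit [NormedSpace ℝ B] in
/-- **The contour arc of a square meeting the ring is preconnected.** [folklore] -/
theorem isPreconnected_ringLevel : IsPreconnected (P.ringLevel q R) := by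
  have hrad := P.isRadial_of_ring hΦ hcl hτI h01 hG hGc hn32 hskelT hR hqR
  have hRm := P.radius_mem_range hqR
  have hℓR := P.ℓ_lt_radius hn32 hR
  obtain ⟨hro, hfl⟩ := P.radialHt_lt_apex_or hΦ hcl hτI h01 hG hGc hn32 hskelT hR hqR
  by_cases hroof : P.roofPat q
  · exact hrad.isPreconnected_levelLine P.gr.hℓ hRm hℓR (P.apex_spec.2.1 q hroof) (hro hroof) (P.continuousOn_bdryHt q)
  · exact hrad.isPreconnected_levelLine_floor P.gr.hℓ hRm hℓR (P.apex_spec.2.2 q hroof) (hfl hroof) (P.continuousOn_bdryHt q)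

include hΦ hcl hτI h01 hG hGc hn32 hskelT hR hqR in
omit [NormedSpace ℝ B] in
/-- **The contour arc of a square meeting the ring is compact.** [folklore] -/
theorem isCompact_ringLevel : IsCompact (P.ringLevel q R) := by
  obtain ⟨hro, hfl⟩ := P.radialHt_lt_apex_or hΦ hcl hτI h01 hG hGc hn32 hskelT hR hqR
  by_cases hroof : P.roofPat q
  · exact isCompact_levelLine P.gr.hℓ (P.apex_spec.2.1 q hroof) (hro hroof) (P.continuousOn_bdryHt q)
  · exact isCompact_levelLine_floor P.gr.hℓ (P.apex_spec.2.2 q hroof) (hfl hroof) (P.continuousOn_bdryHt q)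

include hΦ hcl hτI h01 hG hGc hn32 hskelT hR hqR in
omit [NormedSpace ℝ B] in
/-- **The contour arc meets the boundary of the square exactly on the ring.** [folklore] -/
theorem ringLevel_inter_sphere : P.ringLevel q R ∩ sphere (P.gr.centre q) P.gr.ℓ = sphere (P.gr.centre q) P.gr.ℓ ∩ sphere c₀ R :=
  (P.isRadial_of_ring hΦ hcl hτI h01 hG hGc hn32 hskelT hR hqR).levelLine_inter_sphere P.gr.hℓ (P.radius_mem_range hqR)

include hΦ hcl hτI h01 hG hGc hn32 hskelT hR hqR in
omit [NormedSpace ℝ B] in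
/-- The contour arc is nonempty: it contains the ring points of the boundary. [folklore] -/
theorem ringLevel_nonempty : (P.ringLevel q R).Nonempty := by
  obtain ⟨y, hy, hyR⟩ := P.exists_mem_sphere_ring hn32 hR hqR
  have h : y ∈ P.ringLevel q R ∩ sphere (P.gr.centre q) P.gr.ℓ := by
    rw [P.ringLevel_inter_sphere hΦ hcl hτI h01 hG hGc hn32 hskelT hR hqR]
    exact ⟨hy, mem_sphere.2 hyR⟩
  exact ⟨y, h.1⟩

end Ring

section Wiggly

variable (hΦ : IsFenceOn F Γ τ₀ ε Φ univ) (hcl : ∀ τ ∈ Ioo (τ₀ - ε) (τ₀ + ε), Φ 1 τ = Φ 0 τ) {τ₁ : ℝ}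
  (hτI : uIcc τ₀ τ₁ ⊆ Ioo (τ₀ - ε) (τ₀ + ε)) (h01 : τ₁ ≠ τ₀)
  (hG : ∀ x, L / 2 ≤ dist x c₀ → G x = Φ (angleParam c₀ x) (levelOfParam τ₀ τ₁ (1 - dist x c₀ / L)))
  (hGc : Continuous G) (hn32 : 32 ≤ P.n)
  (hskelT : ∀ q k, P.gr.edge q k '' Icc 0 (2 * P.gr.ℓ) ⊆ {x | 7 * L / 8 ≤ dist x c₀} →
    ∀ s ∈ Icc 0 (2 * P.gr.ℓ), P.skel (P.gr.edge q k s) = G (P.gr.edge q k s))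
  {R : ℝ} (hR : 15 * L / 16 ≤ R)

include hΦ hcl hτI h01 hG hGc hn32 hskelT hR in
omit [NormedSpace ℝ B] in
/-- **The wiggly ring is compact.** [folklore] -/
theorem isCompact_wigglyRing : IsCompact (P.wigglyRing R) := by
  refine (toFinite {q : Fin P.n × Fin P.n | (P.gr.sq q ∩ sphere c₀ R).Nonempty}).isCompact_biUnion fun q hq ↦ ?_
  exact P.isCompact_ringLevel hΦ hcl hτI h01 hG hGc hn32 hskelT hR hq

include hΦ hcl hτI h01 hG hGc hn32 hskelT hR in
omit [NormedSpace ℝ B] in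
/-- **The ring points of the boundaries of the squares lie on the wiggly ring.** [folklore] -/
theorem mem_wigglyRing_of_mem_sphere {q : Fin P.n × Fin P.n} {y : ℝ × ℝ} (hy : y ∈ sphere (P.gr.centre q) P.gr.ℓ)
    (hyR : dist y c₀ = R) : y ∈ P.wigglyRing R := by
  have hqR : (P.gr.sq q ∩ sphere c₀ R).Nonempty := ⟨y, P.gr.sphere_subset_sq q hy, mem_sphere.2 hyR⟩
  refine mem_iUnion₂.2 ⟨q, hqR, ?_⟩
  have h : y ∈ P.ringLevel q R ∩ sphere (P.gr.centre q) P.gr.ℓ := by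
    rw [P.ringLevel_inter_sphere hΦ hcl hτI h01 hG hGc hn32 hskelT hR hqR]
    exact ⟨hy, mem_sphere.2 hyR⟩
  exact h.1

omit [NormedSpace ℝ B] in
/-- The wiggly ring lies in the closed big square. [folklore] -/
theorem wigglyRing_subset : P.wigglyRing R ⊆ closedBall c₀ L := by
  intro x hx
  obtain ⟨q, -, hxq⟩ := mem_iUnion₂.1 hx
  have h := P.gr.sq_subset_S q (P.ringLevel_subset_sq q R hxq)
  rwa [show P.gr.S = closedBall c₀ L from grid_S hL P.hn] at h

end Wiggly

end Foliation.ConePosition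

end Literature.Topology.FourManifolds
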